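import Literature.IUT.HodgeArakelov.CohomologyLimitKummerMLF

/-!
# The Kummer map into the genuine cohomology limit: the three inputs for `A = k̄ˣ` under ANY
# topological group acting through a continuous homomorphism to `G_k` (tempered groups included)

Proof-only companion (abc-iut cell, D-0067 wave 4, seat abc-iut-w4-d007, layer L6; GAP-LEDGER **G-w4d019-1**) of
`CohomologyLimitKummer.lean` / `CohomologyLimitKummerMLF.lean`.  The latter discharges the inputs `hA`, `hfi`,
`hroots` of `h1LimKummer` for abc-iut-L4's `ModelMLFGaloisData` (`ε_k : Π_k ↠ G_k` SURJECTIVE).  The `θ`-side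
groups are not of that shape: for abc-iut-L3's `TemperedCurve` / abc-iut-L2's `ThetaSetting` the augmentation
`Π^tp_X → G_{ℚ_p}` has image `G_K = Gal(K̄/K)`, a FINITE-INDEX subgroup (`[K : ℚ_p] < ∞`), and the sub-
group `Π^tp_Ÿ ⊴ Π^tp_X` of [IUTchII] Prop. 3.1 (ii) has finite-index image too.  HERE the three inputs are
proved in that generality — NO structure, NO instance, NO definition: a topological group `Π` with ANY
`MulDistribMulAction Π k̄ˣ`, a homomorphism `aug : Π → G_k = Gal(k̄/k)` (`k` an MLF, `k̄ = C.K`,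
abc-iut-L4's `MLFClosure C`) and the two honest hypotheses `haug : (g • u : k̄) = aug g u` (the action IS the
Galois action through `aug`) and `Continuous aug`:
* `isOpen_stabilizer_units_of_aug` — stabilisers of units are open (`hA`);
* `finiteIndex_stabilizer_units_of_aug` — and of finite index (`hfi`; NO surjectivity needed:
  `[Π : ε⁻¹ S] = [ε(Π) : ε(Π) ∩ S] ≤ [G_k : S]`);
* `units_eq_one_of_isInvariant_of_aug` — `hroots` for every `H ≤ Π` with `ε(H)` of finite index in `G_k`
  and `K ≤ Π` of finite index (fixed points of `H ⊓ K` lie in a finite `k′/k`, where `⋂ₙ (k′ˣ)ⁿ = 1`,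
  [AbsTopIII] Rmk. 1.5.4 (i) — abc-iut-L4 `MLFClosure.eq_one_of_forall_pos_exists_pow_eq`);
* hence `h1LimKummer_injective_of_aug` — INJECTIVITY of the Kummer map `k̄ˣ → lim_K H¹(H ⊓ K, A')` into
  abc-iut-L6-t1's genuine continuous cohomology limit for every bijective change of coefficient cyclotome
  `c : Λ(k̄ˣ) ⥲ A'` ([IUTchII] Prop. 3.1 (ii) p. 88 "`Ψ_cns := M_TM ⊆ lim_J H¹(Π_Ÿ|_J, Π_μ)`"; Cor. 1.12 (c)
  p. 56 "a natural inclusion `M^×_TM(Π) ↪ lim_J H¹(J, (l·Δ_Θ)(Π))`"), and `h1LimKummer_top_injective_of_aug`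
  for `H = Π` when `ε(Π)` has finite index;
* `TemperedCurve.finiteIndex_range_aug` — for abc-iut-L3's tempered curves `[G_{ℚ_p} : ε(Π^tp_X)] = [K : ℚ_p]`
  is finite, so the above applies verbatim to `Π := Π^tp_X` acting on `ℚ̄_pˣ` through `ε` (with
  `C := MLFClosure.padic p`, abc-iut-L4's `ℚ_p`-model, whose `k̄` IS `PadicAlgCl p`).
S. Mochizuki, *Topics in absolute anabelian geometry III*, Def. 3.1 (i) p. 66, Rmk. 1.5.4 (i) p. 33
[cite: MochizukiAbsTopIII2015, Definition 3.1 (i) p.66]; *Inter-universal Teichmüller theory II*, Prop. 3.1 (ii)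
p. 88 [cite: Mochizuki2012, Prop 3.1 (ii) p.88] (claim key DISPUTED, D-0012; the mathematics is classical
Kummer/Galois theory).  Nothing here bears on [IUTchIII] Cor. 3.12; typed ≠ proved.
-/

namespace Literature.IUT.HodgeArakelov

open Literature.AnabelianGeometry.EtaleTheta Literature.AnabelianGeometry.AbsoluteAnabelian
open CohomologySystemOfContH1

noncomputable section

namespace CohomologySystemOfContH1

variable (C : MLFClosure.{0}) {Γ : Type} [Group Γ] [TopologicalSpace Γ] [IsTopologicalGroup Γ]
  [MulDistribMulAction Γ (C.K)ˣ] (aug : Γ →* (C.K ≃ₐ[C.k] C.K))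
  (haug : ∀ (g : Γ) (u : (C.K)ˣ), ((g • u : (C.K)ˣ) : C.K) = aug g (u : C.K))

/-! ### Stabilisers -/

section Stabilisers

omit [TopologicalSpace Γ] [IsTopologicalGroup Γ] in
include haug in
/-- The stabiliser of a unit in `Π` is `ε⁻¹` of its stabiliser in `G_k` (the action is through `ε`).
[cite: MochizukiAbsTopIII2015, Definition 3.1 (i) p.66] -/
theorem stabilizer_units_eq_comap_of_aug (u : (C.K)ˣ) :
    MulAction.stabilizer Γ u = (MulAction.stabilizer (C.K ≃ₐ[C.k] C.K) (u : C.K)).comap aug := by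
  ext g
  rw [MulAction.mem_stabilizer_iff, Subgroup.mem_comap, MulAction.mem_stabilizer_iff, Units.ext_iff, haug]
  rfl

omit [IsTopologicalGroup Γ] in
include haug in
/-- **Input `hA`**: stabilisers of units are OPEN, for `ε` continuous. [cite: MochizukiAbsTopIII2015, Definition 3.1 (i) p.66] -/
theorem isOpen_stabilizer_units_of_aug (hcont : Continuous aug) (u : (C.K)ˣ) :
    IsOpen (MulAction.stabilizer Γ u : Set Γ) := by
  rw [stabilizer_units_eq_comap_of_aug C aug haug, Subgroup.coe_comap]
  exact (isOpen_stabilizer_gal C (u : C.K)).preimage hcont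

omit [TopologicalSpace Γ] [IsTopologicalGroup Γ] in
include haug in
/-- **Input `hfi`**: stabilisers of units have FINITE INDEX — no surjectivity of `ε` needed:
`[Π : ε⁻¹(S)] = [ε(Π) : ε(Π) ∩ S]`, finite because `[G_k : S]` is. [cite: MochizukiAbsTopIII2015, Definition 3.1 (i) p.66] -/
theorem finiteIndex_stabilizer_units_of_aug (u : (C.K)ˣ) : (MulAction.stabilizer Γ u).FiniteIndex := by
  rw [stabilizer_units_eq_comap_of_aug C aug haug]
  haveI := finiteIndex_stabilizer_gal C (u : C.K)
  refine ⟨?_⟩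
  have h := Subgroup.index_comap (MulAction.stabilizer (C.K ≃ₐ[C.k] C.K) (u : C.K)) aug
  rw [h]
  exact Subgroup.FiniteIndex.index_ne_zero

end Stabilisers

/-! ### Fixed points of a subgroup with finite-index image, and the roots input -/

/-- If `ε(S) ≤ G_k` has finite index, every `x ∈ k̄` fixed by `S` (through `ε`) lies in some fixed FINITE
extension `k′/k` (closure of `ε(S)` is open; Krull topology; Galois correspondence).
[cite: MochizukiAbsTopIII2015, Rmk 1.5.4 (i) p.33] -/
theorem exists_finiteDimensional_forall_mem_of_fixed_of_aug {Γ₀ : Type} [Group Γ₀]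
    (ε : Γ₀ →* (C.K ≃ₐ[C.k] C.K)) (S : Subgroup Γ₀) [hS : (S.map ε).FiniteIndex] :
    ∃ E : IntermediateField C.k C.K, FiniteDimensional C.k E ∧
      ∀ x : C.K, (∀ g : Γ₀, g ∈ S → ε g x = x) → x ∈ E := by
  set Γ : Subgroup (C.K ≃ₐ[C.k] C.K) := (S.map ε).topologicalClosure
  haveI : Γ.FiniteIndex := Subgroup.finiteIndex_of_le (Subgroup.le_topologicalClosure _)
  have hΓo : IsOpen (Γ : Set (C.K ≃ₐ[C.k] C.K)) :=
    Subgroup.isOpen_of_isClosed_of_finiteIndex Γ (Subgroup.isClosed_topologicalClosure _)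
  obtain ⟨E, hEfin, hEsub⟩ :=
    (krullTopology_mem_nhds_one_iff C.k C.K _).mp (hΓo.mem_nhds (Subgroup.one_mem Γ))
  haveI : FiniteDimensional C.k E := hEfin
  refine ⟨E, hEfin, fun x hx => ?_⟩
  have hstab : Γ ≤ MulAction.stabilizer (C.K ≃ₐ[C.k] C.K) x := by
    refine Subgroup.topologicalClosure_minimal _ ?_
      (Subgroup.isClosed_of_isOpen _ (isOpen_stabilizer_gal C x))
    rintro _ ⟨g, hg, rfl⟩
    exact hx g hg
  rw [← InfiniteGalois.fixedField_fixingSubgroup E, IntermediateField.mem_fixedField_iff]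
  intro σ hσ
  exact hstab (hEsub hσ)

omit [TopologicalSpace Γ] [IsTopologicalGroup Γ] in
include haug in
/-- **Input `hroots`**: for `H ≤ Π` with `ε(H)` of finite index in `G_k` and `K ≤ Π` of finite index, a unit of
`k̄` with a compatible system of roots all fixed by `H ⊓ K` equals `1` (`⋂ₙ (k′ˣ)ⁿ = 1` for the finite `k′/k`
containing the roots). [cite: MochizukiAbsTopIII2015, Rmk 1.5.4 (i) p.33] -/
theorem units_eq_one_of_isInvariant_of_aug (H K : Subgroup Γ) [(H.map aug).FiniteIndex] [K.FiniteIndex]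
    (u : (C.K)ˣ) (y : RootSystem u) (hy : y.IsInvariant (H ⊓ K)) : u = 1 := by
  haveI := finiteIndex_map_inf aug H K
  obtain ⟨E, hE, hmem⟩ := exists_finiteDimensional_forall_mem_of_fixed_of_aug C aug (H ⊓ K)
  haveI : FiniteDimensional C.k E := hE
  have hroot : ∀ n : ℕ+, ((y.root n : (C.K)ˣ) : C.K) ∈ E := fun n =>
    hmem _ fun g hg => by
      have h := congrArg (fun v : (C.K)ˣ => (v : C.K)) (hy n ⟨g, hg⟩)
      simpa [haug] using h
  have hu : ((u : (C.K)ˣ) : C.K) ∈ E := by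
    have h := hroot 1
    rwa [y.root_one] at h
  refine Units.ext (MLFClosure.eq_one_of_forall_pos_exists_pow_eq C E hu u.ne_zero fun n hn => ?_)
  refine ⟨(y.root ⟨n, hn⟩ : C.K), hroot ⟨n, hn⟩, ?_⟩
  have h := congrArg (fun v : (C.K)ˣ => (v : C.K)) (y.pow_self ⟨n, hn⟩)
  simpa [Units.val_pow_eq_pow_val] using h

/-! ### Injectivity of the Kummer map into the limit -/

section Assembly

variable {G' : Type} [Group G'] [TopologicalSpace G'] [IsTopologicalGroup G']
  (φ : (TopGroup.of Γ) →* G') (A' : Subgroup G') [A'.Normal] [IsMulCommutative A']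
  (H : Subgroup (TopGroup.of Γ)) [TopologicalSpace (C.K)ˣ]
  (c : CyclotomeCoefficients φ A' (C.K)ˣ)

include haug in
/-- **Injectivity of the Kummer map of `k̄ˣ` into `lim_K H¹(H ⊓ K, A')`** for ANY topological group `Π`
acting on `k̄ˣ` through a continuous `ε : Π → G_k`, every `H ≤ Π` with `ε(H)` of finite index, and every
BIJECTIVE change of coefficient cyclotome `c` (the cyclotomic-rigidity datum) — the tempered situation of
[IUTchII] Prop. 3.1 (ii) ("`Ψ_cns := M_TM ⊆ lim_J H¹(Π_Ÿ|_J, Π_μ)`"). [cite: Mochizuki2012, Prop 3.1 (ii) p.88] -/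
theorem h1LimKummer_injective_of_aug (hcont : Continuous aug) [(Subgroup.map aug H).FiniteIndex]
    (hc : Function.Bijective c.hom) :
    Function.Injective (h1LimKummer φ A' H c (isOpen_stabilizer_units_of_aug C aug haug hcont)
      (finiteIndex_stabilizer_units_of_aug C aug haug)) :=
  h1LimKummer_injective_of_forall_isInvariant_eq_one φ A' H c _ _ hc fun K hK _ u y hy =>
    haveI : K.FiniteIndex := hK
    units_eq_one_of_isInvariant_of_aug C aug haug H K u y hy

include haug in
/-- The same for `H = Π` ("`lim_J H¹(J, ·)`", Cor. 1.12 (c) "a natural inclusion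
`M^×_TM(Π) ↪ lim_J H¹(J, (l·Δ_Θ)(Π))`") whenever `ε(Π) ≤ G_k` has finite index (e.g. `ε(Π) = G_K`, `[K : k] < ∞`).
[cite: Mochizuki2012, Cor 1.12 p.56] -/
theorem h1LimKummer_top_injective_of_aug (hcont : Continuous aug) [aug.range.FiniteIndex]
    (cT : CyclotomeCoefficients φ A' (C.K)ˣ) (hc : Function.Bijective cT.hom) :
    Function.Injective (h1LimKummer φ A' (⊤ : Subgroup (TopGroup.of Γ)) cT
      (isOpen_stabilizer_units_of_aug C aug haug hcont) (finiteIndex_stabilizer_units_of_aug C aug haug)) := by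
  haveI : (Subgroup.map aug (⊤ : Subgroup (TopGroup.of Γ))).FiniteIndex := by
    rw [← MonoidHom.range_eq_map]; infer_instance
  exact h1LimKummer_injective_of_aug C aug haug φ A' ⊤ cT hcont hc

include haug in
/-- **Equivariance + stability** come for free from `CohomologyLimitKummer.lean` (`h1LimKummer_smul`,
`map_h1LimKummer_stable`); recorded here in the form "the Kummer image of a `Π`-stable submonoid of `k̄ˣ` (the
constants `𝒪_k̄^▷`, the units `𝒪_k̄^×`) is stable under the conjugation action on the limit" for `H ⊴ Π`.
[cite: Mochizuki2012, Prop 3.1 (ii) p.88] -/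
theorem map_h1LimKummer_stable_of_aug (hcont : Continuous aug) [H.Normal] (O : Submonoid (C.K)ˣ)
    (hO : ∀ (σ : C.K ≃ₐ[C.k] C.K) (u : (C.K)ˣ), u ∈ O → Units.map (σ : C.K →* C.K) u ∈ O) (g : Γ)
    (y : Multiplicative (h1Lim φ A' H ⊥))
    (hy : y ∈ O.map (h1LimKummer φ A' H c (isOpen_stabilizer_units_of_aug C aug haug hcont)
      (finiteIndex_stabilizer_units_of_aug C aug haug))) :
    h1LimConjMulAut φ A' H g y ∈ O.map (h1LimKummer φ A' H c
      (isOpen_stabilizer_units_of_aug C aug haug hcont) (finiteIndex_stabilizer_units_of_aug C aug haug)) := by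
  refine map_h1LimKummer_stable φ A' H c _ _ O (fun σ u hu => ?_) g y hy
  have hσu : (σ • u : (C.K)ˣ) = Units.map (aug σ : C.K →* C.K) u := Units.ext (haug σ u)
  rw [hσu]
  exact hO (aug σ) u hu

end Assembly

/-! ### The tempered curves of [SemiAnbd] §6: `[G_{ℚ_p} : ε(Π^tp_X)] < ∞` -/

/-- For abc-iut-L3's `TemperedCurve` (the [SemiAnbd] §6 / [EtTh] §1 interface: `ε : Π^tp_X → G_{ℚ_p}` with image
`G_K = Gal(K̄/K)`, `[K : ℚ_p] < ∞`), the image of `ε` has FINITE INDEX `[K : ℚ_p]` in `G_{ℚ_p}` — so the theorems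
above apply to `Π := Π^tp_X` acting on `ℚ̄_pˣ` through `ε`, with `C := MLFClosure.padic p`.
[cite: MochizukiSemiAnbd2006, §6 p.69] -/
theorem TemperedCurve.finiteIndex_range_aug {p : ℕ} [Fact p.Prime]
    (X : Literature.AnabelianGeometry.SemiGraphs.TemperedCurve p) : X.aug.toMonoidHom.range.FiniteIndex := by
  rw [X.range_aug]
  haveI : FiniteDimensional ℚ_[p] X.K := X.finiteDimensional_K
  refine ⟨?_⟩
  rw [← IntermediateField.finrank_eq_fixingSubgroup_index]
  exact Module.finrank_pos.ne'

/-- … and every subgroup `H ≤ Π^tp_X` whose image under `ε` is OPEN in `G_{ℚ_p}` (e.g. a decomposition group,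
`TemperedCurve.isOpen_aug_decomp`; or `Π^tp_Ÿ`, an open subgroup of finite index image) has finite-index image
(open subgroups of the compact group `G_{ℚ_p}` have finite index). [cite: MochizukiSemiAnbd2006, §6 p.71] -/
theorem TemperedCurve.finiteIndex_map_aug_of_isOpen {p : ℕ} [Fact p.Prime]
    (X : Literature.AnabelianGeometry.SemiGraphs.TemperedCurve p) (H : Subgroup X.PiTemp)
    (hH : IsOpen ((H.map X.aug.toMonoidHom : Subgroup _) : Set (Literature.AnabelianGeometry.SemiGraphs.GQp p))) :
    (H.map X.aug.toMonoidHom).FiniteIndex :=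
  haveI := Subgroup.quotient_finite_of_isOpen (H.map X.aug.toMonoidHom) hH
  Subgroup.finiteIndex_of_finite_quotient

end CohomologySystemOfContH1

end

end Literature.IUT.HodgeArakelov
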